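import Mathlib
import HarnessLib

/-!
# The PERIODIC massive-mode rung, brick PM-IId-unif: a pointwise-JOINT two-scale limit is UNIFORM on compact parameter sets
# (free-hands support of ⟨stmt-QuantumFields-24196⟩ `SwapVirialDeficit.ToronSoftnessSharp`; the last step of hypothesis (I3′) of LEAD ym-line-sfw-p2 g96's
# two-scale contract (memo `sfw-p2-g96-memo-24196-PM-design.md` §2/§2½, brick PM-IId) — from the DCT statement
# `Tendsto (V · · ·) ((𝓝[>]0 ×ˢ 𝓝[>]0) ×ˢ 𝓝 a₀) (𝓝 (M a₀))` for every `a₀` of the annulus `r₀ ≤ |a₀| ≤ 1` to BOTH halves of (I3′))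

GENERIC topology: `W : ℝ → ℝ → ℝ → ℝ≥0∞`, `M : ℝ → ℝ≥0∞` finite on a compact `K ⊆ ℝ`, and for every `a₀ ∈ K` the joint limit
`W(u, s, a) → M(a₀)` as `(u, s, a) → (0⁺, 0⁺, a₀)` (`a` within `K`).  Then ★★★ `twoScale_uniform_of_compact`: for every `ε > 0` there is ONE `θ > 0` with
`W u s a ≤ M a + ε` and `M a ≤ W u s a + ε` for all `a ∈ K`, `u, s ∈ (0, θ)` (the limit profile `M` is automatically continuous on `K` in this sense).
★ `twoScale_uniform_annulus`: the instance `K = {r₀ ≤ |a| ≤ 1}`, real `ε′`, plain `𝓝 a₀` — verbatim the two halves of (I3′).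
HONEST LABEL: topology; PM-IId's DCT itself (LEAD g96) is NOT proved here; ⟨24196⟩/⟨24497⟩ OPEN; own crux ⟨22884⟩ OPEN (blocked-on ⟨19935⟩); the Yang–Mills mass gap
is NOT proved; no summit is proved by a line.  Width seat ym-line-sfw-p2-w3 g64 (cell ym-idea-1, free hands), `--supports stmt-QuantumFields-24196`.
THEOREMS ONLY (0 `def`, 0 `sorry`), standard axioms.  References: [folklore] (uniformity of limits on compacta / Dini-type argument); [cite: Luscher1983, §2] for the use.
-/

set_option autoImplicit false

noncomputable section

open Set Filter Topology Metric
open scoped ENNReal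

namespace Summit.QuantumFields.YangMills.Theorems.SwapVirialDeficit.BlowUp

/-- From an eventuality in `(𝓝[>]0 ×ˢ 𝓝[>]0) ×ˢ 𝓝[K] a₀`: a threshold `θ > 0` and a radius `δ > 0`. [folklore] -/
theorem exists_theta_delta_of_eventually {K : Set ℝ} {a₀ : ℝ} {p : (ℝ × ℝ) × ℝ → Prop}
    (h : ∀ᶠ q in (𝓝[>] (0 : ℝ) ×ˢ 𝓝[>] (0 : ℝ)) ×ˢ 𝓝[K] a₀, p q) :
    ∃ θ > (0 : ℝ), ∃ δ > (0 : ℝ), ∀ a : ℝ, dist a a₀ < δ → a ∈ K → ∀ u ∈ Ioo (0 : ℝ) θ, ∀ s ∈ Ioo (0 : ℝ) θ, p ((u, s), a) := by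
  obtain ⟨pa, hpa, pb, hpb, hab⟩ := Filter.eventually_prod_iff.1 h
  obtain ⟨pu, hpu, ps, hps, hus⟩ := Filter.eventually_prod_iff.1 hpa
  obtain ⟨θ₁, hθ₁, hsub₁⟩ := mem_nhdsGT_iff_exists_Ioo_subset.1 hpu
  obtain ⟨θ₂, hθ₂, hsub₂⟩ := mem_nhdsGT_iff_exists_Ioo_subset.1 hps
  obtain ⟨δ, hδ, hball⟩ := Metric.eventually_nhds_iff.1 (eventually_nhdsWithin_iff.1 hpb)
  refine ⟨min θ₁ θ₂, lt_min hθ₁ hθ₂, δ, hδ, fun a ha haK u hu s hs => hab (hus (hsub₁ ⟨hu.1, hu.2.trans_le (min_le_left _ _)⟩)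
    (hsub₂ ⟨hs.1, hs.2.trans_le (min_le_right _ _)⟩)) (hball ha haK)⟩

/-- Conversely, boxes `(0,θ)² × (ball a₀ δ ∩ K)` are eventual for `(𝓝[>]0 ×ˢ 𝓝[>]0) ×ˢ 𝓝[K] a`, `a ∈ ball a₀ δ`. [folklore] -/
theorem eventually_box {K : Set ℝ} {a₀ a : ℝ} {θ δ : ℝ} (hθ : 0 < θ) (ha : dist a a₀ < δ) :
    ∀ᶠ q in (𝓝[>] (0 : ℝ) ×ˢ 𝓝[>] (0 : ℝ)) ×ˢ 𝓝[K] a, q.1.1 ∈ Ioo (0 : ℝ) θ ∧ q.1.2 ∈ Ioo (0 : ℝ) θ ∧ dist q.2 a₀ < δ ∧ q.2 ∈ K := by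
  have hu : ∀ᶠ u in 𝓝[>] (0 : ℝ), u ∈ Ioo (0 : ℝ) θ := Ioo_mem_nhdsGT hθ
  have hb : ∀ᶠ a' in 𝓝[K] a, dist a' a₀ < δ ∧ a' ∈ K := by
    refine eventually_nhdsWithin_iff.2 ?_
    have : ∀ᶠ a' in 𝓝 a, dist a' a₀ < δ := isOpen_ball.mem_nhds (mem_ball.2 ha)
    exact this.mono fun a' h' hK => ⟨h', hK⟩
  exact ((hu.prod_mk hu).prod_mk hb).mono fun q hq => ⟨hq.1.1, hq.1.2, hq.2.1, hq.2.2⟩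

/-- ★★★ **UNIFORMITY ON COMPACTA.**  A pointwise-joint two-scale limit (with the parameter moving within `K`) is uniform on the compact `K`. [folklore] -/
theorem twoScale_uniform_of_compact {K : Set ℝ} (hK : IsCompact K) {W : ℝ → ℝ → ℝ → ℝ≥0∞} {M : ℝ → ℝ≥0∞} (hM : ∀ a ∈ K, M a ≠ ∞)
    (h : ∀ a₀ ∈ K, Tendsto (fun q : (ℝ × ℝ) × ℝ => W q.1.1 q.1.2 q.2) ((𝓝[>] (0 : ℝ) ×ˢ 𝓝[>] (0 : ℝ)) ×ˢ 𝓝[K] a₀) (𝓝 (M a₀)))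
    {ε : ℝ≥0∞} (hε : 0 < ε) :
    ∃ θ > (0 : ℝ), ∀ a ∈ K, ∀ u ∈ Ioo (0 : ℝ) θ, ∀ s ∈ Ioo (0 : ℝ) θ, W u s a ≤ M a + ε ∧ M a ≤ W u s a + ε := by
  have hε2 : 0 < ε / 2 := ENNReal.half_pos hε.ne'
  -- local data at every a₀ (vacuous off K)
  have key : ∀ a₀ : ℝ, ∃ θ > (0 : ℝ), ∃ δ > (0 : ℝ), a₀ ∈ K → ∀ a : ℝ, dist a a₀ < δ → a ∈ K →
      ∀ u ∈ Ioo (0 : ℝ) θ, ∀ s ∈ Ioo (0 : ℝ) θ, W u s a ∈ Icc (M a₀ - ε / 2) (M a₀ + ε / 2) := by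
    intro a₀
    by_cases ha₀ : a₀ ∈ K
    · have hev := (ENNReal.tendsto_nhds (hM a₀ ha₀)).1 (h a₀ ha₀) (ε / 2) hε2
      obtain ⟨θ, hθ, δ, hδ, hP⟩ := exists_theta_delta_of_eventually hev
      exact ⟨θ, hθ, δ, hδ, fun _ => hP⟩
    · exact ⟨1, one_pos, 1, one_pos, fun h' => absurd h' ha₀⟩
  choose θ hθ δ hδ hP using key
  -- the limit profile inherits the box: `M a ∈ Icc (M a₀ − ε/2) (M a₀ + ε/2)` for `a ∈ ball a₀ δ ∩ K`
  have hMbox : ∀ a₀ ∈ K, ∀ a : ℝ, dist a a₀ < δ a₀ → a ∈ K → M a ∈ Icc (M a₀ - ε / 2) (M a₀ + ε / 2) := by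
    intro a₀ ha₀ a ha haK
    have hne : ((𝓝[>] (0 : ℝ) ×ˢ 𝓝[>] (0 : ℝ)) ×ˢ 𝓝[K] a).NeBot :=
      Filter.prod_neBot.2 ⟨Filter.prod_neBot.2 ⟨inferInstance, inferInstance⟩, mem_closure_iff_nhdsWithin_neBot.1 (subset_closure haK)⟩
    refine isClosed_Icc.mem_of_tendsto (h a haK) ?_
    exact (eventually_box (K := K) (hθ a₀) ha).mono fun q hq => hP a₀ ha₀ q.2 hq.2.2.1 hq.2.2.2 q.1.1 hq.1 q.1.2 hq.2.1
  -- finite subcover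
  obtain ⟨t, htK, hcover⟩ := hK.elim_nhds_subcover (fun a => ball a (δ a)) fun a _ => ball_mem_nhds a (hδ a)
  -- one threshold
  obtain ⟨θ₀, hθ₀, hθ₀le⟩ : ∃ θ₀ > (0 : ℝ), ∀ a ∈ t, θ₀ ≤ θ a := by
    rcases t.eq_empty_or_nonempty with ht | ht
    · exact ⟨1, one_pos, by simp [ht]⟩
    · exact ⟨t.inf' ht θ, (Finset.lt_inf'_iff ht).2 fun a _ => hθ a, fun a ha => Finset.inf'_le θ ha⟩
  refine ⟨θ₀, hθ₀, fun a haK u hu s hs => ?_⟩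
  obtain ⟨a₀, ha₀t, ha⟩ : ∃ a₀ ∈ t, a ∈ ball a₀ (δ a₀) := by simpa using hcover haK
  have ha₀K : a₀ ∈ K := htK a₀ ha₀t
  have hu' : u ∈ Ioo (0 : ℝ) (θ a₀) := ⟨hu.1, hu.2.trans_le (hθ₀le a₀ ha₀t)⟩
  have hs' : s ∈ Ioo (0 : ℝ) (θ a₀) := ⟨hs.1, hs.2.trans_le (hθ₀le a₀ ha₀t)⟩
  have hW := hP a₀ ha₀K a (mem_ball.1 ha) haK u hu' s hs'
  have hMa := hMbox a₀ ha₀K a (mem_ball.1 ha) haK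
  have hadd : ε / 2 + ε / 2 = ε := ENNReal.add_halves ε
  constructor
  · calc W u s a ≤ M a₀ + ε / 2 := hW.2
      _ ≤ (M a + ε / 2) + ε / 2 := add_le_add (tsub_le_iff_right.1 hMa.1) le_rfl
      _ = M a + ε := by rw [add_assoc, hadd]
  · calc M a ≤ M a₀ + ε / 2 := hMa.2
      _ ≤ (W u s a + ε / 2) + ε / 2 := add_le_add (tsub_le_iff_right.1 hW.1) le_rfl
      _ = W u s a + ε := by rw [add_assoc, hadd]

/-- The annulus `{r₀ ≤ |a| ≤ 1}` is compact. [folklore] -/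
theorem isCompact_annulus (r₀ : ℝ) : IsCompact {a : ℝ | r₀ ≤ |a| ∧ |a| ≤ 1} := by
  refine (isCompact_Icc (a := (-1 : ℝ)) (b := 1)).of_isClosed_subset ?_ fun a ha => abs_le.1 ha.2
  exact (isClosed_le continuous_const continuous_abs).inter (isClosed_le continuous_abs continuous_const)

/-- ★ **THE ANNULUS INSTANCE = both halves of (I3′).**  From the joint limit at every `a₀` with `r₀ ≤ |a₀| ≤ 1` (plain `𝓝 a₀`, as produced by a dominated-
convergence argument with `a₀` as a parameter) and finiteness of `M` there: one `θ > 0` for the whole annulus, real tolerance `ε′`. [folklore] -/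
theorem twoScale_uniform_annulus {W : ℝ → ℝ → ℝ → ℝ≥0∞} {M : ℝ → ℝ≥0∞} {r₀ : ℝ}
    (hM : ∀ a₀ : ℝ, r₀ ≤ |a₀| → |a₀| ≤ 1 → M a₀ ≠ ∞)
    (h : ∀ a₀ : ℝ, r₀ ≤ |a₀| → |a₀| ≤ 1 →
      Tendsto (fun q : (ℝ × ℝ) × ℝ => W q.1.1 q.1.2 q.2) ((𝓝[>] (0 : ℝ) ×ˢ 𝓝[>] (0 : ℝ)) ×ˢ 𝓝 a₀) (𝓝 (M a₀)))
    {ε' : ℝ} (hε' : 0 < ε') :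
    ∃ θ > (0 : ℝ), ∀ a₀ : ℝ, r₀ ≤ |a₀| → |a₀| ≤ 1 → ∀ u ∈ Ioo (0 : ℝ) θ, ∀ s ∈ Ioo (0 : ℝ) θ,
      W u s a₀ ≤ M a₀ + ENNReal.ofReal ε' ∧ M a₀ ≤ W u s a₀ + ENNReal.ofReal ε' := by
  obtain ⟨θ, hθ, hU⟩ := twoScale_uniform_of_compact (isCompact_annulus r₀) (W := W) (M := M) (fun a ha => hM a ha.1 ha.2)
    (fun a₀ ha₀ => (h a₀ ha₀.1 ha₀.2).mono_left (Filter.prod_mono le_rfl nhdsWithin_le_nhds)) (ENNReal.ofReal_pos.2 hε')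
  exact ⟨θ, hθ, fun a₀ h1 h2 => hU a₀ ⟨h1, h2⟩⟩

end Summit.QuantumFields.YangMills.Theorems.SwapVirialDeficit.BlowUp

end
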